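import Literature.MathematicalPhysics.QuantumLattice.FreeFermiGasPairGramBounds
import Literature.MathematicalPhysics.QuantumLattice.TorusShellCountUniform
import HarnessLib

/-!
# `d`-wave pair long-range order of the free Fermi sea costs kinetic energy at a volume rate

Family `hubbard` / trunk T-QLATTICE. THEOREM (`freeDWavePairing_costs_energy`): for every LRO density
`a > 0` there are `η > 0` and `L₁` such that for all sides `L ≥ L₁`, every particle number `N` and
every unit vector `ψ` of the sector `szSector N 0` of the fermionic torus `(ℤ/Lℤ)²` with
`Re ⟨ψ, Δ_d† Δ_d ψ⟩ ≥ a·L⁴` (`Δ_d = pairField dWaveFormFactor L`), the FREE kinetic energy of `ψ`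
exceeds the free sector ground energy by at least `η·L²`:
`minEnergyOn H₀ (szSector N 0) + η L² ≤ Re ⟨ψ, H₀ ψ⟩`, `H₀ = hubbardTorus 2 L 1 0`; explicitly
`η = 4θ⁶`, `θ = min(a,1)/48`, `L₁ = ⌈384/a⌉ + 3` (`freeDWavePairing_costs_energy_explicit`, `_rate`).

This is (verbatim) the hypothesis `FreeDWavePairingCostsEnergy` of the standing disprover of crux
`BirGroundStateAverageLRO` (route `HubbardSuperconductivity/BalabanIR`, `Cruxes/…/Disproof.lean` §3),
there justified by BCS mean-field asymptotics; here it is proved by an ELEMENTARY route: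

1. pair Gram bounds (`FreeFermiGasPairGramBounds.lean`): `Re ⟨ψ, Δ_d†Δ_d ψ⟩ ≤ 32 L² + 32 (Σ_k t_k)²`
   with `t_k⁴ = u_k v_k ≤ x_k (1 - x_k)`, `x_k = ⟨n_{k↑}⟩`;
2. energy ⇒ few smeared modes (`FreeFermionSectorEnergyDeviation.lean`):
   `Σ_k |ε_k - ε_F| x_k(1-x_k) ≤ X := Re⟨ψ,H₀ψ⟩ - minEnergyOn`; with the uniform shell count
   `#{k : |ε_k - ε_F| ≤ w} ≤ √w L² + 2L` (`card_torusShell_le_sqrt`) and Young's inequality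
   `4λ³ t ≤ t⁴ + 3λ⁴` off the shell: `Σ_k t_k ≤ √w L² + 2L + (X/w + 3λ⁴L²)/(4λ³)`
   (`sum_quarticMean_le`);
3. choosing `w = θ²`, `λ = θ` and assuming `X ≤ 4θ⁶ L²`: `Σ t ≤ 3θL² + 2L`, so
   `Re ⟨Δ_d†Δ_d⟩ ≤ 576 θ² L⁴ + 288 L² ≤ (a/4) L⁴ + 288 L² < a L⁴` once `a·L > 384` — contradiction.

Quantitatively `η(a) ~ a⁶` (the BCS heuristics give `a/log(1/a)`); only `η(a) > 0` matters
downstream: it makes the disprover's window floor (`Negative/LoadBearing.lean`,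
`birGroundStateAverageLRO_window_floor`) UNCONDITIONAL and yields the a-priori bound "ground-state
`d`-wave pair density `c` forces `4(min(c,1)/48)⁶ ≤ U`" for the Hubbard torus at every coupling
`U ≥ 0` (`HubbardPairDensityCouplingFloor.lean`; Summits side `Negative/PairingCost.lean`).

Sources: J. Bardeen, L. N. Cooper, J. R. Schrieffer, Phys. Rev. 108 (1957) 1175, §II; C. N. Yang,
Rev. Mod. Phys. 34 (1962) 694, §3. Folklore finite-dimensional statements; no named facts, no
definitions.

## Mathlib / tree search

Tree: `re_expect_pairField_dWave_le`, `re_expect_pairPresent/Absent_mem_Icc`,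
`re_expect_momentumNumber_mem_Icc`, `sum_abs_sub_fermiLevel_mul_le_energy_excess`,
`exists_eq_two_mul_of_mem_szSector_zero`, `card_torusShell_le_sqrt`, `card_torusSite`.
Mathlib: `Finset.sum_add_sum_compl`, `Finset.sum_le_univ_sum_of_nonneg`, `div_le_iff₀`.
-/

noncomputable section

namespace Literature.MathematicalPhysics.QuantumLattice

open Matrix Finset Literature.Probability.LatticeModels
open scoped ComplexOrder ComplexConjugate

/-! ### The quartic means are controlled by the energy excess -/

section Shell

variable {L : ℕ} [NeZero L]

/-- **Young's inequality in the form used here**: `4λ³t ≤ t⁴ + 3λ⁴`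
(`t⁴ - 4λ³t + 3λ⁴ = (t - λ)²((t + λ)² + 2λ²)`). [folklore] -/
theorem four_mul_cube_mul_le (t lam : ℝ) : 4 * lam ^ 3 * t ≤ t ^ 4 + 3 * lam ^ 4 := by
  nlinarith [mul_nonneg (sq_nonneg (t - lam)) (add_nonneg (sq_nonneg (t + lam)) (mul_nonneg (by norm_num : (0:ℝ) ≤ 2) (sq_nonneg lam)))]

/-- **The sum of the quartic means is small when the energy excess is small.** For `L ≥ 3`, a unit
`ψ ∈ szSector (2n) 0`, and parameters `w, λ > 0`:
`Σ_k t_k ≤ √w·L² + 2L + (X/w + 3λ⁴L²)/(4λ³)`, `X = Re⟨ψ,H₀ψ⟩ - minEnergyOn H₀ (szSector (2n) 0)`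
(on the shell `|ε_k - ε_F| ≤ w` use `t_k ≤ 1` and the uniform shell count; off it, Young and
`t_k⁴ ≤ x_k(1-x_k) ≤ |ε_k - ε_F| x_k(1-x_k)/w`, summed by the deviation bound). [folklore] -/
theorem sum_quarticMean_le (hL : 3 ≤ L) {n : ℕ} {ψ : Fock (Orb (FermionTorus 2 L))}
    (hψ : ψ ∈ szSector (Λ := FermionTorus 2 L) (2 * n) 0) (h1 : star ψ ⬝ᵥ ψ = 1)
    {w lam : ℝ} (hw : 0 < w) (hlam : 0 < lam) :
    ∑ k : TorusSite 2 L, Real.sqrt (Real.sqrt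
        ((star ψ ⬝ᵥ ((momentumNumber k 0 * momentumNumber (-k) 1) *ᵥ ψ)).re *
          (star ψ ⬝ᵥ (((1 - momentumNumber k 0) * (1 - momentumNumber (-k) 1)) *ᵥ ψ)).re)) ≤
      Real.sqrt w * (L : ℝ) ^ 2 + 2 * L +
        (((star ψ ⬝ᵥ (hubbardTorus 2 L 1 0 *ᵥ ψ)).re -
            (hubbardTorus 2 L 1 0).minEnergyOn (szSector (Λ := FermionTorus 2 L) (2 * n) 0)) / w +
          3 * lam ^ 4 * (L : ℝ) ^ 2) / (4 * lam ^ 3) := by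
  obtain ⟨eF, hD⟩ := sum_abs_sub_fermiLevel_mul_le_energy_excess hL hψ h1
  set X : ℝ := (star ψ ⬝ᵥ (hubbardTorus 2 L 1 0 *ᵥ ψ)).re -
    (hubbardTorus 2 L 1 0).minEnergyOn (szSector (Λ := FermionTorus 2 L) (2 * n) 0) with hX
  set x : TorusSite 2 L → ℝ := fun k => (star ψ ⬝ᵥ (momentumNumber k 0 *ᵥ ψ)).re with hx
  set u : TorusSite 2 L → ℝ := fun k =>
    (star ψ ⬝ᵥ ((momentumNumber k 0 * momentumNumber (-k) 1) *ᵥ ψ)).re with hu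
  set v : TorusSite 2 L → ℝ := fun k =>
    (star ψ ⬝ᵥ (((1 - momentumNumber k 0) * (1 - momentumNumber (-k) 1)) *ᵥ ψ)).re with hv
  set t : TorusSite 2 L → ℝ := fun k => Real.sqrt (Real.sqrt (u k * v k)) with ht
  change ∑ k, |torusBand L k - eF| * (x k * (1 - x k)) ≤ X at hD
  have hx1 : ∀ k, x k ≤ 1 := fun k => by
    have := (re_expect_momentumNumber_mem_Icc k 0 ψ).2
    rwa [h1, Complex.one_re] at this
  have hu0 : ∀ k, 0 ≤ u k := fun k => (re_expect_pairPresent_mem_Icc k ψ).1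
  have hux : ∀ k, u k ≤ x k := fun k => (re_expect_pairPresent_mem_Icc k ψ).2
  have hv0 : ∀ k, 0 ≤ v k := fun k => (re_expect_pairAbsent_mem_Icc k ψ).1
  have hvx : ∀ k, v k ≤ 1 - x k := fun k => by
    have := (re_expect_pairAbsent_mem_Icc k ψ).2
    rwa [h1, Complex.one_re] at this
  have ht0 : ∀ k, 0 ≤ t k := fun k => Real.sqrt_nonneg _
  have ht4 : ∀ k, t k ^ 4 = u k * v k := fun k => by
    rw [show t k ^ 4 = (t k ^ 2) ^ 2 by ring, ht]
    simp only
    rw [Real.sq_sqrt (Real.sqrt_nonneg _), Real.sq_sqrt (mul_nonneg (hu0 k) (hv0 k))]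
  have huv : ∀ k, u k * v k ≤ x k * (1 - x k) := fun k =>
    mul_le_mul (hux k) (hvx k) (hv0 k) ((hu0 k).trans (hux k))
  have hx0 : ∀ k, 0 ≤ x k := fun k => (re_expect_momentumNumber_mem_Icc k 0 ψ).1
  have hxx : ∀ k, 0 ≤ x k * (1 - x k) := fun k => mul_nonneg (hx0 k) (by linarith [hx1 k])
  have ht1 : ∀ k, t k ≤ 1 := fun k => by
    have hle : u k * v k ≤ 1 := (huv k).trans (by nlinarith [hx0 k, hx1 k])
    have := Real.sqrt_le_sqrt (Real.sqrt_le_sqrt hle)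
    rwa [Real.sqrt_one, Real.sqrt_one] at this
  -- split the momenta at the shell `|ε_k - ε_F| ≤ w`
  set S : Finset (TorusSite 2 L) := Finset.univ.filter fun k => |torusBand L k - eF| ≤ w with hS
  rw [← Finset.sum_add_sum_compl S]
  -- on the shell: `t ≤ 1` and the uniform shell count
  have hshell : ∑ k ∈ S, t k ≤ Real.sqrt w * (L : ℝ) ^ 2 + 2 * L := by
    calc ∑ k ∈ S, t k ≤ ∑ _k ∈ S, (1 : ℝ) := Finset.sum_le_sum fun k _ => ht1 k
      _ = S.card := by rw [Finset.sum_const, nsmul_eq_mul, mul_one]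
      _ ≤ Real.sqrt w * (L : ℝ) ^ 2 + 2 * L := card_torusShell_le_sqrt eF w
  -- off the shell: Young and the deviation bound
  have hC : 0 < 4 * lam ^ 3 := by positivity
  have hfar : ∀ k ∈ Sᶜ, 4 * lam ^ 3 * t k ≤ |torusBand L k - eF| * (x k * (1 - x k)) / w + 3 * lam ^ 4 := by
    intro k hk
    have hkw : w ≤ |torusBand L k - eF| := by
      rw [Finset.mem_compl, hS, Finset.mem_filter, not_and] at hk
      exact le_of_lt (not_le.1 (hk (Finset.mem_univ k)))
    have hyoung := four_mul_cube_mul_le (t k) lam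
    have h4 : t k ^ 4 ≤ |torusBand L k - eF| * (x k * (1 - x k)) / w := by
      rw [ht4 k, le_div_iff₀ hw]
      calc u k * v k * w ≤ x k * (1 - x k) * w := mul_le_mul_of_nonneg_right (huv k) hw.le
        _ ≤ x k * (1 - x k) * |torusBand L k - eF| := mul_le_mul_of_nonneg_left hkw (hxx k)
        _ = |torusBand L k - eF| * (x k * (1 - x k)) := by ring
    linarith
  have hoff : ∑ k ∈ Sᶜ, t k ≤ (X / w + 3 * lam ^ 4 * (L : ℝ) ^ 2) / (4 * lam ^ 3) := by
    rw [le_div_iff₀ hC, Finset.sum_mul]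
    calc ∑ k ∈ Sᶜ, t k * (4 * lam ^ 3)
        ≤ ∑ k ∈ Sᶜ, (|torusBand L k - eF| * (x k * (1 - x k)) / w + 3 * lam ^ 4) :=
          Finset.sum_le_sum fun k hk => by rw [mul_comm]; exact hfar k hk
      _ = (∑ k ∈ Sᶜ, |torusBand L k - eF| * (x k * (1 - x k))) / w + 3 * lam ^ 4 * (Sᶜ.card : ℝ) := by
          rw [Finset.sum_add_distrib, Finset.sum_div, Finset.sum_const, nsmul_eq_mul, mul_comm]
      _ ≤ X / w + 3 * lam ^ 4 * (L : ℝ) ^ 2 := by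
          have hsub : ∑ k ∈ Sᶜ, |torusBand L k - eF| * (x k * (1 - x k)) ≤ X :=
            (Finset.sum_le_univ_sum_of_nonneg fun k => mul_nonneg (abs_nonneg _) (hxx k)).trans hD
          have hcard : (Sᶜ.card : ℝ) ≤ (L : ℝ) ^ 2 := by
            have := Finset.card_le_univ Sᶜ
            rw [card_torusSite] at this
            exact_mod_cast this
          have hl4 : 0 ≤ 3 * lam ^ 4 := by positivity
          have := div_le_div_of_nonneg_right hsub hw.le
          nlinarith
  linarith

end Shell

/-! ### Assembly: pair LRO of the free Fermi sea costs kinetic energy at a volume rate -/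

section Assembly

variable {L : ℕ} [NeZero L]

/-- **`d`-wave pair LRO costs kinetic energy — explicit constants.** For `a > 0`, `L ≥ 3` with
`a·L > 384`, and a unit vector `ψ ∈ szSector (2n) 0` with `Re ⟨ψ, Δ_d†Δ_d ψ⟩ ≥ a·L⁴`:
`minEnergyOn H₀ (szSector (2n) 0) + 4θ⁶·L² < Re ⟨ψ, H₀ ψ⟩`, `θ = min(a,1)/48`,
`H₀ = hubbardTorus 2 L 1 0`. Bardeen–Cooper–Schrieffer (1957) §II. [folklore] -/
theorem freeDWavePairing_costs_energy_explicit {a : ℝ} (ha : 0 < a) (hL : 3 ≤ L)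
    (hLa : 384 < a * L) {n : ℕ} {ψ : Fock (Orb (FermionTorus 2 L))}
    (hψ : ψ ∈ szSector (Λ := FermionTorus 2 L) (2 * n) 0) (h1 : star ψ ⬝ᵥ ψ = 1)
    (hY : a * (L : ℝ) ^ 4 ≤
      (star ψ ⬝ᵥ (((pairField dWaveFormFactor L)ᴴ * pairField dWaveFormFactor L) *ᵥ ψ)).re) :
    (hubbardTorus 2 L 1 0).minEnergyOn (szSector (Λ := FermionTorus 2 L) (2 * n) 0) +
        4 * (min a 1 / 48) ^ 6 * (L : ℝ) ^ 2 <
      (star ψ ⬝ᵥ (hubbardTorus 2 L 1 0 *ᵥ ψ)).re := by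
  set θ : ℝ := min a 1 / 48 with hθ
  have hθ0 : 0 < θ := by rw [hθ]; positivity
  have hθa : 576 * θ ^ 2 ≤ a / 4 := by
    have hm1 : min a 1 ≤ 1 := min_le_right _ _
    have hma : min a 1 ≤ a := min_le_left _ _
    have hm0 : 0 < min a 1 := lt_min ha one_pos
    rw [hθ]
    nlinarith
  set X : ℝ := (star ψ ⬝ᵥ (hubbardTorus 2 L 1 0 *ᵥ ψ)).re -
    (hubbardTorus 2 L 1 0).minEnergyOn (szSector (Λ := FermionTorus 2 L) (2 * n) 0) with hX
  by_contra hcon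
  have hXle : X ≤ 4 * θ ^ 6 * (L : ℝ) ^ 2 := by rw [hX]; linarith
  -- the quartic-mean sum with `w = θ²`, `λ = θ`
  set T : ℝ := ∑ k : TorusSite 2 L, Real.sqrt (Real.sqrt
        ((star ψ ⬝ᵥ ((momentumNumber k 0 * momentumNumber (-k) 1) *ᵥ ψ)).re *
          (star ψ ⬝ᵥ (((1 - momentumNumber k 0) * (1 - momentumNumber (-k) 1)) *ᵥ ψ)).re)) with hT
  have hT0 : 0 ≤ T := Finset.sum_nonneg fun k _ => Real.sqrt_nonneg _
  have hL1 : (1 : ℝ) ≤ L := by exact_mod_cast (show 1 ≤ L by omega)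
  have hL0 : (0 : ℝ) < L := by linarith
  have hTle : T ≤ 3 * θ * (L : ℝ) ^ 2 + 2 * L := by
    have h := sum_quarticMean_le hL hψ h1 (w := θ ^ 2) (lam := θ) (by positivity) hθ0
    rw [← hT, ← hX, Real.sqrt_sq hθ0.le] at h
    have hfrac : (X / θ ^ 2 + 3 * θ ^ 4 * (L : ℝ) ^ 2) / (4 * θ ^ 3) ≤ 7 / 4 * θ * (L : ℝ) ^ 2 := by
      rw [div_le_iff₀ (by positivity)]
      have hX' : X / θ ^ 2 ≤ 4 * θ ^ 4 * (L : ℝ) ^ 2 := by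
        rw [div_le_iff₀ (by positivity)]
        nlinarith
      nlinarith
    nlinarith
  have hY' := re_expect_pairField_dWave_le ψ h1
  rw [← hT] at hY'
  -- `a L⁴ ≤ 32 L² + 32 T² ≤ 576 θ² L⁴ + 288 L² ≤ (a/4) L⁴ + 288 L²`
  have hT2 : T ^ 2 ≤ 18 * θ ^ 2 * (L : ℝ) ^ 4 + 8 * (L : ℝ) ^ 2 := by
    nlinarith [sq_nonneg (3 * θ * (L : ℝ) ^ 2 - 2 * L)]
  have hL4 : 0 < (L : ℝ) ^ 4 := by positivity
  have hmain : a * (L : ℝ) ^ 4 ≤ a / 4 * (L : ℝ) ^ 4 + 288 * (L : ℝ) ^ 2 := by nlinarith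
  -- hence `a L² ≤ 384`, contradicting `a L > 384`
  have hL2 : a * (L : ℝ) ^ 2 ≤ 384 := by nlinarith
  nlinarith

/-- **`d`-wave pair LRO costs kinetic energy — the rate at given side.** For `a > 0`, every side
`L ≥ ⌈384/a⌉ + 3`, every `N` and every unit `ψ ∈ szSector N 0` with `Re ⟨ψ, Δ_d†Δ_d ψ⟩ ≥ a·L⁴`:
`minEnergyOn H₀ (szSector N 0) + 4(min(a,1)/48)⁶ · L² ≤ Re ⟨ψ, H₀ ψ⟩` (`N` is even, or the sector is
trivial). Bardeen–Cooper–Schrieffer (1957) §II. [folklore] -/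
theorem freeDWavePairing_costs_energy_rate {a : ℝ} (ha : 0 < a) {L : ℕ} [NeZero L]
    (hL : ⌈384 / a⌉₊ + 3 ≤ L) {N : ℕ} {ψ : Fock (Orb (FermionTorus 2 L))}
    (hψ : ψ ∈ szSector (Λ := FermionTorus 2 L) N 0) (h1 : star ψ ⬝ᵥ ψ = 1)
    (hY : a * (L : ℝ) ^ 4 ≤
      (star ψ ⬝ᵥ (((pairField dWaveFormFactor L)ᴴ * pairField dWaveFormFactor L) *ᵥ ψ)).re) :
    (hubbardTorus 2 L 1 0).minEnergyOn (szSector (Λ := FermionTorus 2 L) N 0) +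
        4 * (min a 1 / 48) ^ 6 * (L : ℝ) ^ 2 ≤
      (star ψ ⬝ᵥ (hubbardTorus 2 L 1 0 *ᵥ ψ)).re := by
  have hL3 : 3 ≤ L := by omega
  have hLa : 384 < a * L := by
    have hceil : 384 / a ≤ (⌈384 / a⌉₊ : ℝ) := Nat.le_ceil _
    have hL' : (⌈384 / a⌉₊ : ℝ) + 3 ≤ (L : ℝ) := by exact_mod_cast hL
    have : 384 / a < (L : ℝ) := by linarith
    rwa [div_lt_iff₀' ha] at this
  have h0 : ψ ≠ 0 := by rintro rfl; simp at h1
  obtain ⟨n, rfl⟩ := exists_eq_two_mul_of_mem_szSector_zero hψ h0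
  exact le_of_lt (freeDWavePairing_costs_energy_explicit ha hL3 hLa hψ h1 hY)

/-- **`d`-wave pair long-range order of the free Fermi sea costs kinetic energy at a volume rate**
(verbatim the hypothesis `FreeDWavePairingCostsEnergy` of the disprover of crux
`BirGroundStateAverageLRO`, now a theorem): for every `a > 0` there are `η > 0` (`η = 4(min(a,1)/48)⁶`)
and `L₁` (`= ⌈384/a⌉ + 3`) such that for all `L ≥ L₁`, all `N` and all unit `ψ ∈ szSector N 0` of the
fermionic torus with `Re ⟨ψ, Δ_d†Δ_d ψ⟩ ≥ a L⁴`: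
`minEnergyOn H₀ (szSector N 0) + η L² ≤ Re ⟨ψ, H₀ ψ⟩`, `H₀ = hubbardTorus 2 L 1 0`.
Bardeen–Cooper–Schrieffer (1957) §II; Yang (1962) §3. [folklore] -/
theorem freeDWavePairing_costs_energy :
    ∀ a : ℝ, 0 < a → ∃ η : ℝ, 0 < η ∧ ∃ L₁ : ℕ, ∀ (L : ℕ) [NeZero L], L₁ ≤ L →
      ∀ (N : ℕ) (ψ : Fock (Orb (FermionTorus 2 L))),
        ψ ∈ szSector (Λ := FermionTorus 2 L) N 0 → star ψ ⬝ᵥ ψ = 1 →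
        a * (L : ℝ) ^ 4 ≤
          (star ψ ⬝ᵥ ((pairField dWaveFormFactor L)ᴴ * pairField dWaveFormFactor L) *ᵥ ψ).re →
        (hubbardTorus 2 L 1 0).minEnergyOn (szSector (Λ := FermionTorus 2 L) N 0) + η * (L : ℝ) ^ 2 ≤
          (star ψ ⬝ᵥ (hubbardTorus 2 L 1 0) *ᵥ ψ).re := by
  intro a ha
  exact ⟨4 * (min a 1 / 48) ^ 6, by positivity, ⌈384 / a⌉₊ + 3,
    fun L _ hL N ψ hψ h1 hY => freeDWavePairing_costs_energy_rate ha hL hψ h1 hY⟩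

end Assembly

end Literature.MathematicalPhysics.QuantumLattice
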